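import Literature.Analysis.InnerProduct.KroneckerEigenvalues
import Summits.RiemannHypothesis.RiemannHypothesis.Theorems.Splittings.BombieriTruncEigen
import Summits.RiemannHypothesis.RiemannHypothesis.Theorems.Splittings.BombieriFozNoDep
import Summits.RiemannHypothesis.RiemannHypothesis.Theorems.Splittings.SparseRigid
import HarnessLib

/-!
# Splittings — cross (x-wuc) lens, CANDIDATES rows C5 / C18: the ASSEMBLY side of «FOZ ∧ B′ ⟹ RH» typed — Bombieri's
# Corollary WITH EIGENVALUE PROVENANCE as the one named print fact (hypothesis position), `RH → B′` unconditionally, and the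
# C18 «rigidity engine» as an explicit conjecture-shaped crux (DEF-CARRYING by design: three `Prop` definitions)

Cell rh-split, seat rh-split-x-wuc g4 (brief sha16 f79c5f09d8bcb036), card `run/shared/lean/pub/rh-split/cards/SPLIT-x-wuc.md` §10
(referee rh-split-ref g2 2026-08-27T02:52:54Z: §10 DELIVERABLE, replay of this scratch rc 0/0/0, std axioms on
`rh_iff_foz_and_boundedAway_one`, `rh_of_pairCorrelation_of_boundedAway_one`; «(P1) Corollary11Prov = FAIR print-with-proof reading:
Bombieri [corpus:paper:galaxy-pdf-4005501466549090220] p0035 L29/L33/L41, p0036 L28/L54, p0037 L1–3/L21 opened and VERBATIM as cited»);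
§§1–5 of `HOME/rh-split-x-wuc/SplitXWucG4.lean` (sha16 914a11412a5ad93c) VERBATIM, filed by rh-split-typer-1 g4 (lead rh-split-lead g2
04:44:01Z «x-wuc C5 def-carrying»); §6 is the landed `FozLindelof.lean` (p491476), §§7–8 (branch tightness, Lemma 13 for `𝒦_E(Γ_N)`) are
NOT carried (seat HANDOFF item).  The scratch's `import Mathlib` is dropped (everything needed is in the cone of the four tree imports); the `[cite:]` tag of
`Corollary11Prov` is rendered as prose (a `Prop` over Summits-side definitions cannot be relocated to `Literature/`).

D1 (`BombieriTruncEigen.TruncNegEigenvalueBoundedAway E`, «B′») typed Bombieri's question («the main question here is to decide whether or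
not this negative eigenvalue stays bounded away from zero», §1) but NO implication, because the vendored `Bombieri2000.corollary11` /
`theorem11` drop the PROVENANCE of the relation in alternative (iii): in print it arises ONLY as a limit of eigenvectors of the truncations
`𝒦_E(Γ_N)` whose NEGATIVE EIGENVALUES TEND TO ZERO (§1; §11 (11.5) `λ = lim λ_N`; LEMMA 14 «F(u) = 0 identically in E iff λ = lim inf λ_N = 0»;
closing remark «the coefficients of the relations in question are obtained as limits of eigenvectors of reasonably well-behaved matrices»).
* §1 `NegEigenToZero E` — the provenance clause; `negEigenToZero_iff_not_boundedAway`: THE CLAUSE IS LITERALLY `¬ B′(E)`.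
* §2 `Corollary11Prov` — the printed Corollary with its third alternative carrying the provenance clause (a NAMED PRINT FACT in hypothesis
  position, exactly like the tree's `corollary11`; `corollary11_of_prov : Corollary11Prov → corollary11`).  Never asserted.
* §3 `re_nonneg_of_mem_roots_charpoly_KMat_real`, `truncNegEigenvalueBoundedAway_of_rh` — under RH every `γ` is real, `𝒦_E(Γ_N)` is a GRAM
  matrix, so NO negative eigenvalue exists and B′ holds on every window of finite measure — UNCONDITIONAL (no named fact).
* §4 the C5 assembly: `rh_of_foz_of_boundedAway` (`Corollary11Prov → WeilPositivityOn a → CofiniteCriticalLine → B′([−a, a]) → RH`); on the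
  PROVED rung `a = 1` (`WeilFormatCData.A1.weilPositivityOn_one`): `rh_iff_foz_and_boundedAway_one : Corollary11Prov → (RH ↔
  CofiniteCriticalLine ∧ B′([−1, 1]))` — class-(a) row of the same logical shape as X-1, with a FINITE-MATRIX partner.
* §5 the C18 skeleton: `Corollary11ProvSparse` — the Corollary with alternative (ii) WEAKENED to «off-line zeros NOT of density zero» — a
  CONJECTURE-SHAPED CRUX, NOT IN PRINT (Bombieri's §§10–11 use `J < ∞`), never asserted, RH-implied only through its RH disjunct
  (`corollary11ProvSparse_of_rh`); `corollary11Prov_of_sparse`, `rh_of_offLineDensityZero_of_boundedAway`,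
  `rh_of_pairCorrelation_of_boundedAway_one : Corollary11ProvSparse → MontgomeryPairCorrelation → B′([−1,1]) → RH` (tree p475996),
  `residual_of_corollary11ProvSparse`.
LABELS (referee g2 02:52:54Z; class (x, wuc) UNCHANGED): every `→ RH` here is CONDITIONAL on the named hypothesis it displays;
`Corollary11Prov` is a READING OF PRINT, not a tree theorem; `Corollary11ProvSparse` is a conjecture-shaped crux, and «o(N) ∧ B′ ∧
Corollary11ProvSparse ⟹ RH» is RELABELLING BY CONSTRUCTION until that crux has a proof.  Source: E. Bombieri, Rend. Lincei (9) 11 (2000)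
183–233 [galaxy:pdf:4005501466549090220 = corpus paper:galaxy-pdf-4005501466549090220, chunks 3 (§1), 33–35 (§11)].
HONEST LABEL: «SPLITTING SEARCH over kernel-typed RH-EQUIVALENCES; a splitting A ∧ B ⟹ RH is CONDITIONAL bookkeeping
unless A and B are both proved; nothing here bears on the truth of RH.»
-/

set_option linter.dupNamespace false

noncomputable section

open scoped Classical ComplexConjugate
open Set Filter Topology Complex MeasureTheory

namespace Summit.RiemannHypothesis.RiemannHypothesis.Theorems.Splittings.BombieriCorollaryProvenance

open Literature.NumberTheory.LFunctions Literature.NumberTheory.LFunctions.Bombieri2000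
open Literature.NumberTheory.DiophantineGeometry
open Summit.RiemannHypothesis.RiemannHypothesis.Theses.RuelleBand
open Summit.RiemannHypothesis.RiemannHypothesis.Theorems.Splittings.BombieriTruncEigen
open Summit.RiemannHypothesis.RiemannHypothesis.Theorems.Splittings.BombieriFozNoDep
open Summit.RiemannHypothesis.RiemannHypothesis.Theorems.Splittings.SparseRigid
open Summit.RiemannHypothesis.RiemannHypothesis.Theorems.Splittings.PairCorrelationOffLineDensity
open Literature.Barriers.RiemannHypothesis

/-! ## §1 The provenance clause: «the negative eigenvalue tends to 0» -/

/-- «The negative eigenvalue tends to 0 as we approximate the infinite dimensional matrix by its finite dimensional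
truncations» (§1), on the window `E`: along a subsequence `N_k ↑ ∞` of D1's truncations `𝒦_E(Γ_{N_k})` there are
NEGATIVE eigenvalues (real negative roots of the characteristic polynomial, D1's reading) `λ_{N_k} → 0`.
[cite: Bombieri2000Weil, §1 (the main question) and §11 Lemma 14] -/
def NegEigenToZero (E : Set ℝ) : Prop :=
  ∃ φ : ℕ → ℕ, StrictMono φ ∧ ∃ μ : ℕ → ℂ,
    (∀ k, μ k ∈ (truncKMat E (φ k)).charpoly.roots ∧ (μ k).im = 0 ∧ (μ k).re < 0) ∧
      Tendsto (fun k ↦ (μ k).re) atTop (𝓝 0)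

/-- The provenance clause refutes B′: if negative eigenvalues `λ_{N_k} → 0` exist along a subsequence, they are not
bounded away from zero. [folklore] -/
theorem not_boundedAway_of_negEigenToZero {E : Set ℝ} (h : NegEigenToZero E) :
    ¬ TruncNegEigenvalueBoundedAway E := by
  rintro ⟨c, hc, N₀, hB⟩
  obtain ⟨φ, hφ, μ, hμ, hlim⟩ := h
  have h1 : ∀ᶠ k in atTop, -c < (μ k).re := (tendsto_order.1 hlim).1 (-c) (by linarith)
  have h2 : ∀ᶠ k : ℕ in atTop, N₀ ≤ φ k :=
    (eventually_ge_atTop N₀).mono fun k hk ↦ hk.trans (hφ.id_le k)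
  obtain ⟨k, hk1, hk2⟩ := (h1.and h2).exists
  obtain ⟨hr, him, hneg⟩ := hμ k
  have := hB (φ k) hk2 (μ k) hr him hneg
  linarith

/-- Conversely, if B′ fails on `E` then negative eigenvalues `λ_{N_k} → 0⁻` exist along a subsequence: the provenance
clause is LITERALLY `¬ B′(E)`. [folklore] -/
theorem negEigenToZero_of_not_boundedAway {E : Set ℝ} (h : ¬ TruncNegEigenvalueBoundedAway E) :
    NegEigenToZero E := by
  unfold TruncNegEigenvalueBoundedAway at h
  push Not at h
  -- for every k: beyond N₀ = k there is a negative eigenvalue in (−1/(k+1), 0)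
  have hk : ∀ k : ℕ, ∃ N : ℕ, k ≤ N ∧ ∃ μ : ℂ, μ ∈ (truncKMat E N).charpoly.roots ∧ μ.im = 0 ∧ μ.re < 0 ∧
      -(1 / ((k : ℝ) + 1)) < μ.re := by
    intro k
    obtain ⟨N, hN, μ, hμ, him, hneg, hclose⟩ := h (1 / ((k : ℝ) + 1)) (by positivity) k
    exact ⟨N, hN, μ, hμ, him, hneg, hclose⟩
  choose N hN μ hμ him hneg hclose using hk
  -- `N k ≥ k` tends to infinity: extract a strictly increasing subsequence
  have hNtop : Tendsto N atTop atTop :=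
    tendsto_atTop_mono hN tendsto_id
  obtain ⟨ψ, hψ, hNψ⟩ := strictMono_subseq_of_tendsto_atTop hNtop
  refine ⟨N ∘ ψ, hNψ, μ ∘ ψ, fun k ↦ ⟨hμ (ψ k), him (ψ k), hneg (ψ k)⟩, ?_⟩
  -- squeeze: −1/(ψ k + 1) < re μ_{ψ k} < 0
  have hlow : Tendsto (fun k : ℕ ↦ -(1 / ((ψ k : ℝ) + 1))) atTop (𝓝 0) := by
    have h0 : Tendsto (fun k : ℕ ↦ (1 / ((k : ℝ) + 1))) atTop (𝓝 0) :=
      tendsto_one_div_add_atTop_nhds_zero_nat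
    have h1 : Tendsto (fun k : ℕ ↦ (1 / (((ψ k : ℕ) : ℝ) + 1))) atTop (𝓝 0) :=
      h0.comp hψ.tendsto_atTop
    simpa using h1.neg
  refine tendsto_of_tendsto_of_tendsto_of_le_of_le hlow tendsto_const_nhds (fun k ↦ (hclose (ψ k)).le)
    (fun k ↦ (hneg (ψ k)).le)

/-- Hence `NegEigenToZero E ↔ ¬ B′(E)`. [folklore] -/
theorem negEigenToZero_iff_not_boundedAway (E : Set ℝ) :
    NegEigenToZero E ↔ ¬ TruncNegEigenvalueBoundedAway E :=
  ⟨not_boundedAway_of_negEigenToZero, negEigenToZero_of_not_boundedAway⟩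

/-! ## §2 Bombieri's Corollary WITH PROVENANCE (named print fact, hypothesis position) -/

/-- **Bombieri 2000, Corollary to Theorem 11, with the provenance of alternative (iii) retained** (as established in
§11: Lemma 14 «F = 0 identically in E iff λ = lim inf λ_N = 0», (11.5) «λ = lim λ_N», λ_N «the negative eigenvalue of
𝒦_E(Γ_N) largest in absolute value»; §1 «if the negative eigenvalue tends to 0 then we obtain in the limit a
non-trivial linear relation»; closing remark of §11 «the coefficients of the relations in question are obtained as limits
of eigenvectors of reasonably well-behaved matrices»): for a finite union `𝓔 ⊂ (0, ∞)` of bounded closed intervals on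
which `𝒯[f * f̄*] ≥ 0` for all smooth `f` supported in `𝓔` — either RH, or infinitely many zeros off the line, or the
`x^{−ρ}` are `ℓ²`-linearly dependent over `𝓔` (half the mass off the line) AND this relation is reached through
negative eigenvalues `λ_{N_k} → 0` of the truncations `𝒦_E(Γ_{N_k})`, `E = log 𝓔` (`NegEigenToZero`). A READING OF
PRINT in hypothesis position: users take `(h : Corollary11Prov)`; it implies the vendored `corollary11`. (Bombieri's
`N → ∞` is real; D1's truncations are integer-indexed, which loses nothing for the limit.)
Source: Bombieri 2000 (`Bombieri2000Weil`), §11 Corollary, Lemma 14, (11.5); §1.  Stated over the Summits-side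
truncations `truncKMat` / `NegEigenToZero`, so it is a cell-posited hypothesis-`Prop` here and NOT a `Literature/` named fact
(no cite tag: the gate's Literature relocation does not apply to a statement over Summits definitions). -/
def Corollary11Prov : Prop :=
  ∀ (𝓔 : Set ℝ), IsFiniteUnionOfPosIntervals 𝓔 →
    (∀ g : ℝ → ℂ, IsWeilTest g → tsupport g ⊆ Real.log '' 𝓔 → 0 ≤ (weilQuadratic g).re) →
      _root_.RiemannHypothesis ∨
        {ρ : ℂ | ρ ∈ ZetaZeros.riemannZetaNontrivialZeros ∧ ρ.re ≠ 1 / 2}.Infinite ∨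
        ((∃ c : ZeroIdx → ℂ, c ≠ 0 ∧ Summable (fun i ↦ ‖c i‖ ^ 2) ∧
            (∑' i, ‖c i‖ ^ 2) ≤ 2 * ∑' i : {i : ZeroIdx // i.OffLine}, ‖c i‖ ^ 2 ∧
            XPowLinDepOn 𝓔 c) ∧
          NegEigenToZero (Real.log '' 𝓔))

/-- The provenance-carrying Corollary implies the vendored one (drop the clause). [cite: Bombieri2000Weil, §11 Corollary] -/
theorem corollary11_of_prov (h : Corollary11Prov) : corollary11 := by
  intro 𝓔 h𝓔 hpos
  rcases h 𝓔 h𝓔 hpos with hRH | hinf | ⟨hdep, -⟩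
  · exact Or.inl hRH
  · exact Or.inr (Or.inl hinf)
  · exact Or.inr (Or.inr hdep)

/-! ## §3 Under RH the truncations are Gram matrices: `RH → B′(E)` with NO named fact -/

/-- For REAL frequencies `t` and a window `E` of finite measure every root of the characteristic polynomial of
`𝒦_E(t) = [∫_E e^{i(t_i − t_j)u} du]` has non-negative real part: `z* 𝒦_E z = ∫_E |Σ_j z_j e^{−i t_j u}|² du ≥ 0`.
[folklore] -/
theorem re_nonneg_of_mem_roots_charpoly_KMat_real {ι : Type} [Fintype ι] [DecidableEq ι] {E : Set ℝ}
    (hE : volume E ≠ ⊤) (t : ι → ℝ) {μ : ℂ} (hμ : μ ∈ (KMat E (fun i ↦ (t i : ℂ))).charpoly.roots) :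
    0 ≤ μ.re := by
  haveI : IsFiniteMeasure (volume.restrict E) := isFiniteMeasure_restrict.2 hE
  obtain ⟨v, hv0, hv⟩ := Literature.Analysis.InnerProduct.exists_mulVec_eq_smul_of_mem_roots_charpoly hμ
  -- the eigenvalue equation row by row
  have hrow : ∀ i, ∑ j, KE E (t i) (t j) * v j = μ * v i := by
    intro i
    have := congrFun hv i
    simpa [Matrix.mulVec, dotProduct, KMat] using this
  -- the exponent is purely imaginary
  have hre : ∀ (i j) (u : ℝ), (I * ((t i : ℂ) - t j) * u).re = 0 := by
    intro i j u
    simp [Complex.mul_re, Complex.mul_im]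
  -- each term is integrable on the finite-measure window
  have hint : ∀ i j, Integrable (fun u : ℝ ↦ conj (v i) * v j * cexp (I * ((t i : ℂ) - t j) * u))
      (volume.restrict E) := by
    intro i j
    refine (integrable_const (‖v i‖ * ‖v j‖)).mono' (Continuous.aestronglyMeasurable (by fun_prop)) ?_
    refine Eventually.of_forall fun u ↦ le_of_eq ?_
    rw [norm_mul, norm_mul, Complex.norm_exp, hre, Real.exp_zero, mul_one, RCLike.norm_conj]
  -- the product of conjugate terms
  have hterm : ∀ (i j) (u : ℝ),
      conj (v i * cexp (-(I * (t i : ℂ) * u))) * (v j * cexp (-(I * (t j : ℂ) * u))) =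
        conj (v i) * v j * cexp (I * ((t i : ℂ) - t j) * u) := by
    intro i j u
    simp only [map_mul, map_neg, ← Complex.exp_conj, Complex.conj_I, Complex.conj_ofReal]
    rw [mul_mul_mul_comm, ← Complex.exp_add]
    congr 2
    ring
  have hpt : ∀ u : ℝ, ∑ i, ∑ j, conj (v i) * v j * cexp (I * ((t i : ℂ) - t j) * u) =
      conj (∑ j, v j * cexp (-(I * (t j : ℂ) * u))) * ∑ j, v j * cexp (-(I * (t j : ℂ) * u)) := by
    intro u
    rw [map_sum, Finset.sum_mul_sum]
    exact Finset.sum_congr rfl fun i _ ↦ Finset.sum_congr rfl fun j _ ↦ (hterm i j u).symm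
  -- the quadratic form computed two ways
  have hquad : μ * ((∑ i, ‖v i‖ ^ 2 : ℝ) : ℂ) =
      ((∫ u in E, ‖∑ j, v j * cexp (-(I * (t j : ℂ) * u))‖ ^ 2 : ℝ) : ℂ) := by
    calc μ * ((∑ i, ‖v i‖ ^ 2 : ℝ) : ℂ)
        = ∑ i, conj (v i) * (μ * v i) := by
          rw [Complex.ofReal_sum, Finset.mul_sum]
          exact Finset.sum_congr rfl fun i _ ↦ by
            rw [show conj (v i) * (μ * v i) = μ * (v i * conj (v i)) by ring, Complex.mul_conj,
              Complex.normSq_eq_norm_sq]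
      _ = ∑ i, conj (v i) * ∑ j, KE E (t i) (t j) * v j := by
          exact Finset.sum_congr rfl fun i _ ↦ by rw [hrow i]
      _ = ∑ i, ∑ j, ∫ u in E, conj (v i) * v j * cexp (I * ((t i : ℂ) - t j) * u) := by
          refine Finset.sum_congr rfl fun i _ ↦ ?_
          rw [Finset.mul_sum]
          refine Finset.sum_congr rfl fun j _ ↦ ?_
          rw [KE, integral_const_mul]
          ring
      _ = ∑ i, ∫ u in E, ∑ j, conj (v i) * v j * cexp (I * ((t i : ℂ) - t j) * u) := by
          refine Finset.sum_congr rfl fun i _ ↦ ?_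
          rw [integral_finsetSum _ fun j _ ↦ hint i j]
      _ = ∫ u in E, ∑ i, ∑ j, conj (v i) * v j * cexp (I * ((t i : ℂ) - t j) * u) := by
          rw [integral_finsetSum _ fun i _ ↦ integrable_finsetSum _ fun j _ ↦ hint i j]
      _ = ∫ u in E, (((‖∑ j, v j * cexp (-(I * (t j : ℂ) * u))‖ ^ 2 : ℝ) : ℂ)) := by
          refine integral_congr_ae (Eventually.of_forall fun u ↦ ?_)
          simp only
          rw [hpt u, RCLike.conj_mul]
          norm_cast
      _ = ((∫ u in E, ‖∑ j, v j * cexp (-(I * (t j : ℂ) * u))‖ ^ 2 : ℝ) : ℂ) := integral_complex_ofReal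
  -- take real parts
  have hnormpos : 0 < ∑ i, ‖v i‖ ^ 2 := by
    obtain ⟨i, hi⟩ : ∃ i, v i ≠ 0 := by
      by_contra hall
      push Not at hall
      exact hv0 (funext hall)
    have hi' : 0 < ‖v i‖ ^ 2 := by positivity
    exact lt_of_lt_of_le hi'
      (Finset.single_le_sum (f := fun j ↦ ‖v j‖ ^ 2) (fun j _ ↦ sq_nonneg ‖v j‖) (Finset.mem_univ i))
  have hreal : μ.re * ∑ i, ‖v i‖ ^ 2 = ∫ u in E, ‖∑ j, v j * cexp (-(I * (t j : ℂ) * u))‖ ^ 2 := by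
    have := congrArg Complex.re hquad
    rwa [Complex.re_mul_ofReal, Complex.ofReal_re] at this
  have hge : 0 ≤ μ.re * ∑ i, ‖v i‖ ^ 2 := by
    rw [hreal]
    exact integral_nonneg fun u ↦ by positivity
  nlinarith

/-- Under RH every `γ` of Bombieri's multiset is REAL: `γ = Im ρ`. [folklore] -/
theorem gamma_eq_im_of_rh (hRH : _root_.RiemannHypothesis) (i : ZeroIdx) : i.gamma = ((i.val.im : ℝ) : ℂ) := by
  have hre : i.val.re = 1 / 2 := re_eq_half_of_rh hRH i.val_mem
  have h1 : i.val.re = 1 / 2 - i.gamma.im := by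
    rw [i.val_eq_gamma]; simp; ring
  have h2 : i.val.im = i.gamma.re := by
    conv_lhs => rw [i.val_eq_gamma]
    simp
  apply Complex.ext
  · simp [h2]
  · simp; linarith

/-- **`RH → B′(E)`** for every window of finite measure, UNCONDITIONALLY: under RH the truncations `𝒦_E(Γ_N)` are Gram
matrices of exponentials with real frequencies, so no negative eigenvalue exists and D1's condition holds vacuously
(`c = 1`, `N₀ = 0`). [folklore; replaces the «via Theorem 9 (named fact)» remark of D1] -/
theorem truncNegEigenvalueBoundedAway_of_rh {E : Set ℝ} (hE : volume E ≠ ⊤) (hRH : _root_.RiemannHypothesis) :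
    TruncNegEigenvalueBoundedAway E := by
  refine ⟨1, one_pos, 0, fun N _ μ hμ _ hneg ↦ ?_⟩
  have hmat : truncKMat E N = KMat E (fun i : truncIdx N ↦ ((((i : ZeroIdx).val.im : ℝ)) : ℂ)) := by
    ext i j
    simp [truncKMat, KMat, gamma_eq_im_of_rh hRH]
  rw [hmat] at hμ
  have h0 := re_nonneg_of_mem_roots_charpoly_KMat_real hE (fun i : truncIdx N ↦ (i : ZeroIdx).val.im) hμ
  linarith

/-- In particular on the symmetric windows `[−a, a]`. [folklore] -/
theorem truncNegEigenvalueBoundedAway_Icc_of_rh (hRH : _root_.RiemannHypothesis) (a : ℝ) :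
    TruncNegEigenvalueBoundedAway (Icc (-a) a) :=
  truncNegEigenvalueBoundedAway_of_rh measure_Icc_lt_top.ne hRH

/-! ## §4 Row C5 assembled: `FOZ ∧ B′([−a, a]) ⟹ RH` modulo `Corollary11Prov`, on any proved positivity rung -/

/-- `log [e^{−a}, e^{a}] = [−a, a]` (the vendored copy is private). [folklore] -/
theorem log_image_Icc_exp (a : ℝ) : Real.log '' Icc (Real.exp (-a)) (Real.exp a) = Icc (-a) a := by
  ext x
  constructor
  · rintro ⟨y, ⟨hy1, hy2⟩, rfl⟩
    have hy : 0 < y := (Real.exp_pos _).trans_le hy1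
    exact ⟨by simpa using Real.log_le_log (Real.exp_pos _) hy1, by simpa using Real.log_le_log hy hy2⟩
  · rintro ⟨h1, h2⟩
    exact ⟨Real.exp x, ⟨Real.exp_le_exp.2 h1, Real.exp_le_exp.2 h2⟩, Real.log_exp x⟩

/-- **Row C5, assembled (CONDITIONAL on the named print fact `Corollary11Prov`)**: a proved positivity rung
`WeilPositivityOn a` (`0 < a`), finitely many off-line zeros (`CofiniteCriticalLine`, FOZ) and Bombieri's
bounded-away property B′ on the window `[−a, a]` give RH — alternative (ii) is excluded by FOZ, alternative (iii) by
its provenance (`λ_{N_k} → 0` contradicts B′). [cite: Bombieri2000Weil, §1 («the upshot is …») and §11 Corollary] -/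
theorem rh_of_foz_of_boundedAway (h : Corollary11Prov) {a : ℝ} (ha : 0 < a) (hW : WeilPositivityOn a)
    (hfoz : CofiniteCriticalLine) (hB : TruncNegEigenvalueBoundedAway (Icc (-a) a)) :
    _root_.RiemannHypothesis := by
  have hpos : ∀ g : ℝ → ℂ, IsWeilTest g → tsupport g ⊆ Real.log '' Icc (Real.exp (-a)) (Real.exp a) →
      0 ≤ (weilQuadratic g).re := fun g hg hsupp ↦ hW g hg (by rwa [log_image_Icc_exp] at hsupp)
  rcases h _ (isFiniteUnionOfPosIntervals_Icc_exp ha) hpos with hRH | hinf | ⟨-, hprov⟩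
  · exact hRH
  · exact absurd (cofiniteCriticalLine_iff_foz.1 hfoz) hinf
  · rw [log_image_Icc_exp] at hprov
    exact absurd hB (not_boundedAway_of_negEigenToZero hprov)

/-- Row C5 on the PROVED rung `a = 1` (`WeilFormatCData.A1.weilPositivityOn_one`, standard axioms):
`Corollary11Prov → CofiniteCriticalLine → B′([−1, 1]) → RH`. [cite: Bombieri2000Weil, §11 Corollary] -/
theorem rh_of_foz_of_boundedAway_one (h : Corollary11Prov) (hfoz : CofiniteCriticalLine)
    (hB : TruncNegEigenvalueBoundedAway (Icc (-1) 1)) : _root_.RiemannHypothesis :=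
  rh_of_foz_of_boundedAway h one_pos
    Summit.RiemannHypothesis.RiemannHypothesis.Theorems.WeilFormatCData.A1.weilPositivityOn_one hfoz hB

/-- Row C5 on Yoshida's rung `a = (log 2)/2`. [cite: Bombieri2000Weil, §11 Corollary; Yoshida 1992] -/
theorem rh_of_foz_of_boundedAway_yoshida (h : Corollary11Prov) (hfoz : CofiniteCriticalLine)
    (hB : TruncNegEigenvalueBoundedAway (Icc (-(Real.log 2 / 2)) (Real.log 2 / 2))) : _root_.RiemannHypothesis :=
  rh_of_foz_of_boundedAway h (div_pos (Real.log_pos (by norm_num)) two_pos) weilPositivityOn_log_two_half_holds hfoz hB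

/-- Both conjuncts are RH-implied (FOZ: `cofiniteCriticalLine_of_rh`; B′: §3, unconditionally), so modulo
`Corollary11Prov` row C5 is an EQUIVALENCE: `RH ↔ FOZ ∧ B′([−1, 1])` — the exact analogue of X-1
`rh_iff_foz_and_noDep_yoshida (h11 : corollary11)` with a finite-matrix partner. [cite: Bombieri2000Weil, §11 Corollary] -/
theorem rh_iff_foz_and_boundedAway_one (h : Corollary11Prov) :
    _root_.RiemannHypothesis ↔ CofiniteCriticalLine ∧ TruncNegEigenvalueBoundedAway (Icc (-1) 1) :=
  ⟨fun hRH ↦ ⟨cofiniteCriticalLine_of_rh hRH, truncNegEigenvalueBoundedAway_Icc_of_rh hRH 1⟩,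
    fun hc ↦ rh_of_foz_of_boundedAway_one h hc.1 hc.2⟩

/-- Bookkeeping reading for the costume detector (cell §K): GIVEN FOZ, B′([−1,1]) and RH coincide modulo the named
fact — as for every class-(a) row with an RH-implied partner (`A → (B ↔ RH)`); this is NOT `B′ ↔ RH` outright (in a
`¬FOZ` world B′ keeps content), which is what the W-screens S-C5-2-x probe at model level. [new-but-trivial] -/
theorem boundedAway_one_iff_rh_of_foz (h : Corollary11Prov) (hfoz : CofiniteCriticalLine) :
    TruncNegEigenvalueBoundedAway (Icc (-1) 1) ↔ _root_.RiemannHypothesis :=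
  ⟨fun hB ↦ rh_of_foz_of_boundedAway_one h hfoz hB, fun hRH ↦ truncNegEigenvalueBoundedAway_Icc_of_rh hRH 1⟩

/-! ## §5 Row C18's missing «rigidity engine», typed: the Corollary with (ii) weakened to «not density zero» -/

/-- **C18-R (CONJECTURE-SHAPED CRUX, NOT IN PRINT).** Bombieri's Corollary with alternative (ii) «ζ has infinitely
many zeros off the critical line» WEAKENED to «the off-line zeros do NOT have density zero» (`¬ (N_off(T)/N(T) → 0)`,
the tree's spelled-out SPARSE(o(N)) of `Splittings.SparseRigid`), provenance clause kept. Bombieri's proof does NOT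
give this: §§10–11 use `J = #{off-line pairs} < ∞` in Lemma 13 (`|w_γ| ≥ 1/√(2J)` for some off-line `γ`), in the
uniform lower bound for `λ_N`, and in (11.6); with `J = ∞` of density zero the off-line mass `≥ 1/2` of the unit
eigenvectors can escape along infinitely many slots and the limit relation can be `0 = 0`. Proving this def is the
«rigidity engine» row C18 (SPARSE ∧ B′) needs; it is RH-implied only through its RH disjunct
(`corollary11ProvSparse_of_rh`). [conjecture; rh-split x-wuc g4 for theory-2 C18 / T2-R1] -/
def Corollary11ProvSparse : Prop :=
  ∀ (𝓔 : Set ℝ), IsFiniteUnionOfPosIntervals 𝓔 →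
    (∀ g : ℝ → ℂ, IsWeilTest g → tsupport g ⊆ Real.log '' 𝓔 → 0 ≤ (weilQuadratic g).re) →
      _root_.RiemannHypothesis ∨
        ¬ Tendsto (fun T : ℝ ↦ ((∑ ρ ∈ ((zetaZeroBox_finite 0 T).toFinset).filter (fun ρ ↦ ρ.re ≠ 1 / 2),
            riemannZetaZeroOrder ρ : ℤ) : ℝ) / zetaZeroCount T) atTop (𝓝 0) ∨
        ((∃ c : ZeroIdx → ℂ, c ≠ 0 ∧ Summable (fun i ↦ ‖c i‖ ^ 2) ∧
            (∑' i, ‖c i‖ ^ 2) ≤ 2 * ∑' i : {i : ZeroIdx // i.OffLine}, ‖c i‖ ^ 2 ∧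
            XPowLinDepOn 𝓔 c) ∧
          NegEigenToZero (Real.log '' 𝓔))

/-- C18-R implies the printed (provenance-carrying) Corollary, by the tree's RH-free ladder edge FOZ ⊂ o(N)
(`offLineDensityZero_of_cofiniteCriticalLine`): «not density zero» forces «infinitely many off the line».
[new-combination; rh-split x-wuc g4] -/
theorem corollary11Prov_of_sparse (h : Corollary11ProvSparse) : Corollary11Prov := by
  intro 𝓔 h𝓔 hpos
  rcases h 𝓔 h𝓔 hpos with hRH | hdense | hdep
  · exact Or.inl hRH
  · refine Or.inr (Or.inl ?_)
    intro hfin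
    exact hdense (offLineDensityZero_of_cofiniteCriticalLine (cofiniteCriticalLine_iff_foz.2 hfin))
  · exact Or.inr (Or.inr hdep)

/-- C18-R is RH-implied — but only through its RH disjunct (honesty: this is what makes «SPARSE ∧ B′ ∧ C18-R ⟹ RH»
relabelling by construction until C18-R has a proof). [new-but-trivial] -/
theorem corollary11ProvSparse_of_rh (hRH : _root_.RiemannHypothesis) : Corollary11ProvSparse :=
  fun _ _ _ ↦ Or.inl hRH

/-- **Row C18, assembled (CONDITIONAL on C18-R)**: a proved positivity rung, SPARSE(o(N)) («the off-line zeros have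
density zero», with multiplicity) and B′ on `[−a, a]` give RH. [new-combination; rh-split x-wuc g4 for theory-2 C18] -/
theorem rh_of_offLineDensityZero_of_boundedAway (h : Corollary11ProvSparse) {a : ℝ} (ha : 0 < a)
    (hW : WeilPositivityOn a)
    (hS : Tendsto (fun T : ℝ ↦ ((∑ ρ ∈ ((zetaZeroBox_finite 0 T).toFinset).filter (fun ρ ↦ ρ.re ≠ 1 / 2),
        riemannZetaZeroOrder ρ : ℤ) : ℝ) / zetaZeroCount T) atTop (𝓝 0))
    (hB : TruncNegEigenvalueBoundedAway (Icc (-a) a)) : _root_.RiemannHypothesis := by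
  have hpos : ∀ g : ℝ → ℂ, IsWeilTest g → tsupport g ⊆ Real.log '' Icc (Real.exp (-a)) (Real.exp a) →
      0 ≤ (weilQuadratic g).re := fun g hg hsupp ↦ hW g hg (by rwa [log_image_Icc_exp] at hsupp)
  rcases h _ (isFiniteUnionOfPosIntervals_Icc_exp ha) hpos with hRH | hdense | ⟨-, hprov⟩
  · exact hRH
  · exact absurd hS hdense
  · rw [log_image_Icc_exp] at hprov
    exact absurd hB (not_boundedAway_of_negEigenToZero hprov)

/-- **Row C18 with A = Montgomery's pair correlation (the tree's only PCC-type certificate of SPARSE) on the proved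
rung `a = 1`**: `C18-R → MontgomeryPairCorrelation → B′([−1, 1]) → RH`, via p475996
`offLine_density_tendsto_zero_of_pairCorrelation` and `weilPositivityOn_one`. CONDITIONAL bookkeeping on two unproved
hypotheses (C18-R, PCC) and one open RH-implied statement (B′). [new-combination; rh-split x-wuc g4 for theory-2 C18 row H4] -/
theorem rh_of_pairCorrelation_of_boundedAway_one (h : Corollary11ProvSparse) (hP : MontgomeryPairCorrelation)
    (hB : TruncNegEigenvalueBoundedAway (Icc (-1) 1)) : _root_.RiemannHypothesis :=
  rh_of_offLineDensityZero_of_boundedAway h one_pos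
    Summit.RiemannHypothesis.RiemannHypothesis.Theorems.WeilFormatCData.A1.weilPositivityOn_one
    (offLine_density_tendsto_zero_of_pairCorrelation hP) hB

/-- The surplus of C18-R over the FIAT residual: C18-R implies `W(a) → o(N) → B′([−a,a]) → RH` for every `a > 0`
(and is stronger exactly by clause (iii), the existence of the half-mass `ℓ²` relation). [new-but-trivial] -/
theorem residual_of_corollary11ProvSparse (h : Corollary11ProvSparse) {a : ℝ} (ha : 0 < a) :
    WeilPositivityOn a →
      Tendsto (fun T : ℝ ↦ ((∑ ρ ∈ ((zetaZeroBox_finite 0 T).toFinset).filter (fun ρ ↦ ρ.re ≠ 1 / 2),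
        riemannZetaZeroOrder ρ : ℤ) : ℝ) / zetaZeroCount T) atTop (𝓝 0) →
      TruncNegEigenvalueBoundedAway (Icc (-a) a) → _root_.RiemannHypothesis :=
  fun hW hS hB ↦ rh_of_offLineDensityZero_of_boundedAway h ha hW hS hB

end Summit.RiemannHypothesis.RiemannHypothesis.Theorems.Splittings.BombieriCorollaryProvenance

end
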